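import Summits.NavierStokesRegularity.NavierStokesRegularity.Theorems.ExtremiserTransienceTwoThirdsPieceIntegralsAdm
import Summits.NavierStokesRegularity.NavierStokesRegularity.Theorems.ExtremiserTransienceTwoThirdsPieceExcess
import HarnessLib

/-!
# Route `ExtremiserTransience`, crux `NearExtremalTransiencePerFlow` (stmt-NavierStokesRegularity-26567),
# LINE g10-1 «two_thirds» (ns-idea-10), stub S1a′ — BRICK 2, lemma P3e″: THE LOCALISED SHARP INEQUALITY WITH EXCESS — ADMISSIBLE PIECE

`--supports stmt-NavierStokesRegularity-26567` (helper; prover seat ns-net-p2 g13).  Verbatim `piece_excess_set` (`…TwoThirdsPieceExcessSet`) for a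
piece `φ` that is ADMISSIBLE in κ⋆'s class (smooth, divergence free, `‖φ‖ ≤ 1+m`, `‖Dφ‖ ≤ B'`, `D⁰,D¹,D² ∈ L²`) but not compactly supported —
the remainder piece `w − Σ_c φ_c` of a packing (`admissible_add_smul`): `piece_excess_adm`.
HONEST FRAMING: nothing about Navier–Stokes is proved; no summit is proved by a line. [folklore]
-/

noncomputable section

open scoped Topology InnerProductSpace RealInnerProductSpace ENNReal NNReal ContDiff
open MeasureTheory Filter Set Metric
open Literature.Analysis.FluidPDE
open Summit.NavierStokesRegularity.NavierStokesRegularity.Theorems.DepletionLadder.KStar.HalfSpace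
open Summit.NavierStokesRegularity.NavierStokesRegularity.Theorems.DepletionLadder
open Summit.NavierStokesRegularity.NavierStokesRegularity.Theorems.NearExtremalTransiencePerFlow.LocalMaximiser

namespace Summit.NavierStokesRegularity.NavierStokesRegularity.Theorems.NearExtremalTransiencePerFlow.TwoThirds

-- the summit's namespace repeats the problem name by convention (D-0017)
set_option linter.dupNamespace false

section ExcessAdm

variable {w φ : E3 → E3} {χ : E3 → ℝ} {B Bp : Set E3} {A₁ m m₃ j₁ j₂ : ℝ}

/-- **THE LOCALISED SHARP INEQUALITY WITH EXCESS for an admissible (not compactly supported) piece** over measurable sets. [folklore] -/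
theorem piece_excess_adm (hw : ContDiff ℝ (⊤ : ℕ∞) w) (hDw : ∀ x, ‖fderiv ℝ w x‖ ≤ A₁)
    (h1 : ∫⁻ x, ‖iteratedFDeriv ℝ 1 w x‖ₑ ^ 2 < ⊤) (h2 : ∫⁻ x, ‖iteratedFDeriv ℝ 2 w x‖ₑ ^ 2 < ⊤)
    (hφ : ContDiff ℝ (⊤ : ℕ∞) φ) (hφdiv : VectorCalculus.IsDivFree φ) {B' : ℝ} (hφB : ∀ x, ‖fderiv ℝ φ x‖ ≤ B')
    (hφ0 : ∫⁻ x, ‖iteratedFDeriv ℝ 0 φ x‖ₑ ^ 2 < ⊤) (hφ1 : ∫⁻ x, ‖iteratedFDeriv ℝ 1 φ x‖ₑ ^ 2 < ⊤)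
    (hφ2 : ∫⁻ x, ‖iteratedFDeriv ℝ 2 φ x‖ₑ ^ 2 < ⊤)
    (hm : 0 ≤ m) (hM : ∀ x, ‖φ x‖ ≤ 1 + m) (hBm : MeasurableSet B) (hBpm : MeasurableSet Bp) (hsubB : B ⊆ Bp)
    (hχc : Continuous χ) (hχ01 : ∀ x, 0 ≤ χ x ∧ χ x ≤ 1) (hone : ∀ x ∈ B, χ x = 1)
    (hχout : ∀ x, x ∉ Bp → χ x = 0)
    (he1 : ∀ x, x ∉ Bp \ B → curl φ x - χ x • curl w x = 0)
    (hi1 : Integrable fun x => ‖curl φ x - χ x • curl w x‖ ^ 2) (hj₁ : ∫ x, ‖curl φ x - χ x • curl w x‖ ^ 2 ≤ j₁)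
    (he2 : ∀ x, x ∉ Bp \ B → fderiv ℝ (curl φ) x - χ x • fderiv ℝ (curl w) x = 0)
    (hi2 : Integrable fun x => ‖fderiv ℝ (curl φ) x - χ x • fderiv ℝ (curl w) x‖ ^ 2)
    (hj₂ : ∫ x, ‖fderiv ℝ (curl φ) x - χ x • fderiv ℝ (curl w) x‖ ^ 2 ≤ j₂)
    (hm₃ : 0 ≤ m₃) (he3 : ∀ x, ‖fderiv ℝ φ x - χ x • fderiv ℝ w x‖ ≤ m₃) {t : ℝ} (ht : 0 < t) :
    (∫ x in B, sd w x) - kStar * Real.sqrt ((∫ x in B, zd w x) * (∫ x in B, wd w x)) ≤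
      kStar * (m / 2 * ((∫ x in B, zd w x) + (2 * ((∫ x in Bp, zd w x) - (∫ x in B, zd w x)) + 2 * j₁) + (∫ x in B, wd w x) + (2 * ((∫ x in Bp, wd w x) - (∫ x in B, wd w x)) + 6 * j₂)) +
        t / 2 * ((∫ x in B, zd w x) + (∫ x in B, wd w x)) +
        (1 / (2 * t) + 1 / 2) * ((2 * ((∫ x in Bp, zd w x) - (∫ x in B, zd w x)) + 2 * j₁) + (2 * ((∫ x in Bp, wd w x) - (∫ x in B, wd w x)) + 6 * j₂))) +
      (2 * A₁ * ((∫ x in Bp, zd w x) - (∫ x in B, zd w x)) + 2 * A₁ * j₁) +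
      m₃ * ((∫ x in B, zd w x) + (2 * ((∫ x in Bp, zd w x) - (∫ x in B, zd w x)) + 2 * j₁)) := by
  have hw2 : ContDiff ℝ 2 w := hw.of_le (by norm_cast)
  have hw3 : ContDiff ℝ 3 w := hw.of_le (by norm_cast)
  have hφ2' : ContDiff ℝ 2 φ := hφ.of_le (by norm_cast)
  have hφ3' : ContDiff ℝ 3 φ := hφ.of_le (by norm_cast)
  have izφ : Integrable (fun x => ‖curl φ x‖ ^ 2) := (integrable_norm_curl_sq hφ2' hφ1).1
  have iwφ : Integrable (fun x => frobeniusNormSq (fderiv ℝ (curl φ) x)) := (integrable_frobeniusNormSq_fderiv_curl hφ3' hφ2).1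
  have isφ : Integrable (sd φ) := KStar.integrable_stretching hφ hφB hφ1
  have hZ := Zen_piece_le_adm hw2 h1 izφ hBm hBpm hsubB hχ01 hχout he1 hi1 hj₁
  have hW := Wpa_piece_le_adm hw3 h2 iwφ hBm hBpm hsubB hχ01 hχout he2 hi2 hj₂
  have hJ := Jst_piece_ge_adm hw hDw h1 isφ izφ hBm hBpm hsubB hχc hχ01 hone hχout he1 hi1 hj₁ he3
  have hsharp : Jst φ ≤ kStar * (1 + m) * Real.sqrt (Zen φ) * Real.sqrt (Wpa φ) :=
    (le_abs_self _).trans (sharpDepletion_is_universal φ (1 + m) B' hφ hφdiv hM hφB hφ0 hφ1 hφ2)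
  -- signs
  have izd : Integrable (zd w) := (integrable_norm_curl_sq hw2 h1).1
  have iwd : Integrable (wd w) := (integrable_frobeniusNormSq_fderiv_curl hw3 h2).1
  have hZb0 : 0 ≤ (∫ x in B, zd w x) := setIntegral_nonneg hBm fun x _ => sq_nonneg _
  have hWb0 : 0 ≤ (∫ x in B, wd w x) := setIntegral_nonneg hBm fun x _ => frobeniusNormSq_nonneg _
  have hZL : (∫ x in B, zd w x) ≤ (∫ x in Bp, zd w x) :=
    setIntegral_mono_set izd.integrableOn (ae_of_all _ fun x => sq_nonneg _) (Eventually.of_forall hsubB)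
  have hWL : (∫ x in B, wd w x) ≤ (∫ x in Bp, wd w x) :=
    setIntegral_mono_set iwd.integrableOn (ae_of_all _ fun x => frobeniusNormSq_nonneg _) (Eventually.of_forall hsubB)
  have hZL0 : 0 ≤ (∫ x in Bp, zd w x) - (∫ x in B, zd w x) := by linarith only [hZL]
  have hWL0 : 0 ≤ (∫ x in Bp, wd w x) - (∫ x in B, wd w x) := by linarith only [hWL]
  have hj₁0 : 0 ≤ j₁ := (integral_nonneg fun x => sq_nonneg _).trans hj₁
  have hj₂0 : 0 ≤ j₂ := (integral_nonneg fun x => sq_nonneg _).trans hj₂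
  have hA₁ : 0 ≤ A₁ := (norm_nonneg _).trans (hDw 0)
  exact excess_algebra (le_of_lt kStar_pos) hm hm₃ ht hZb0 hWb0 (by positivity) (by positivity) hsharp hZ hW
    (by linarith only [hJ])


end ExcessAdm

end Summit.NavierStokesRegularity.NavierStokesRegularity.Theorems.NearExtremalTransiencePerFlow.TwoThirds

end
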